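import Literature.NumberTheory.Automorphic.ResGLnCuspidalCohomologyApexAssembly
import Literature.NumberTheory.Automorphic.ResGLnCuspidalCohomologyApexModule
import HarnessLib

/-!
# Clozel's Lemme 3.14/3.15 for `Res_{K/ℚ} GLₙ`: reduction of the apex fact to a non-zero basic cochain
# of a `(𝔤, K_∞)`-submodule of the `K(𝔫)`-invariants

Topic `NumberTheory/Automorphic`; namespace `Literature.NumberTheory.Automorphic.ConeDictionary`
(vocabulary of `ResGLnCuspidalCohomologyApex{Module,Kuga,Assembly}`).  Theorems only; no named fact,
no `sorry`.

`ResGLnCuspidalCohomologyApexAssembly.Clozel1990_exists_basic_levelFixed_cocycle_of_nonzero_cochain`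
reduces the apex fact `Clozel1990_exists_basic_levelFixed_cocycle` to the existence, for every clean
cohomological cuspidal `π` of `GL_n(𝔸_K)` with a `K(𝔫)`-fixed form, of a NON-ZERO level-`𝔫`-fixed cochain
`η ∈ C^{q+1}(𝔤, K_∞; W ⊗ (E_λ ⊗ ε_S))` with `i_Z η = 0`.  Here this is transported, with the cochain map
`(j ⊗ 1)_*` of `ResGLnCuspidalCohomologyApexModule`, to an arbitrary `(𝔤, K_∞)`-module `(V, ρK, ρ𝔤)` with an
INJECTIVE intertwiner `j : V → W` taking values in the `K(𝔫)`-invariants `e_{K(𝔫)} W` — in print `V = π_∞`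
(or `π_∞ ⊗ π_f^{K(𝔫)}`) embedded in `W^{K(𝔫)}`:

* `exists_nonzero_levelFixed_basic_of_moduleHom` — `(j ⊗ 1)_*` maps a non-zero cochain of
  `C^{q+1}(𝔤, K_∞; V ⊗ (E_λ ⊗ ε_S))` with `i_Z = 0` to a non-zero, level-`𝔫`-fixed cochain of
  `C^{q+1}(𝔤, K_∞; W ⊗ (E_λ ⊗ ε_S))` with `i_Z = 0` (`(j ⊗ 1)_*` is a map of `(𝔤, K_∞)`-complexes,
  commutes with insertions, is injective, and its values are `K(𝔫)`-fixed);
* **`Clozel1990_exists_basic_levelFixed_cocycle_of_nonzero_moduleCochain`** — the apex fact follows from: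
  for every `n ≥ 2`, `𝔫 ≠ 0`, dominant `λ` and clean cohomological cuspidal `π` with a non-zero `K(𝔫)`-fixed
  form there are a set `S` of real places, a `(𝔤, K_∞)`-module `V` with an injective intertwiner into
  `e_{K(𝔫)} W`, and a non-zero cochain `z ∈ C^{q+1}(𝔤, K_∞; V ⊗ (E_λ ⊗ ε_S))` with `i_Z z = 0`.  For
  `V = π_∞ ↪ W^{K(𝔫)}` (an irreducible unitary `(𝔤, K_∞)`-module with the infinitesimal character of
  `E_λ^∨`) the remaining input is the `K_∞`-type statement `Hom_{K_∞}(Λ^{q+1}(𝔤/(𝔨 ⊕ ℝZ)), π_∞ ⊗ E_λ ⊗ ε_S) ≠ 0`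
  of Clozel's Lemme 3.14 (Vogan–Zuckerman's criterion).

[cite: Clozel1990, Lemme 3.14 (p. 114), Lemme 3.15 (p. 121), §3.5 (p. 123)] [cite: BorelWallach2000, I §5.1]

## References

* L. Clozel, *Motifs et formes automorphes: applications du principe de fonctorialité*, in:
  Automorphic forms, Shimura varieties, and L-functions I (Ann Arbor 1988), Perspect. Math. 10,
  Academic Press 1990: Lemme 3.14 (p. 114), Lemme 3.15 (p. 121), p. 123. [Clozel1990]
* A. Borel, N. Wallach, *Continuous cohomology, discrete subgroups, and representations of reductive
  groups*, 2nd ed., AMS 2000: I §5.1 (held). [BorelWallach2000]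
-/

noncomputable section

open scoped Classical TensorProduct Matrix
open NumberField IsDedekindDomain NumberField.InfinitePlace NumberField.mixedEmbedding

namespace Literature.NumberTheory.Automorphic

-- Mathlib idiom (as in `GKModules` and the whole cone dictionary): commutator bracket on `Module.End`
attribute [local instance 100] LieRing.ofAssociativeRing

namespace ConeDictionary

open ResGLnCohomology BigHeckeGLn RealMatrixGroup Literature.Algebra.Lie.ChevalleyEilenberg

section Transport

variable {n : ℕ} {K : Type} [Field K] [NumberField K] {hcpt : isCompact_glFiniteIntegralLevel n K}
  (π : AutomorphicRepData (AutomorphyDatum.gl n K hcpt))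
  {V : Type} [AddCommGroup V] [Module ℂ V]
  {ρK : Representation ℂ (AutomorphyDatum.gl n K hcpt).arch.maximalCompact V}
  {ρ𝔤 : (AutomorphyDatum.gl n K hcpt).arch.lie →ₗ⁅ℝ⁆ Module.End ℂ V}
  (had : ∀ (k : (AutomorphyDatum.gl n K hcpt).arch.maximalCompact) (X : (AutomorphyDatum.gl n K hcpt).arch.lie),
    ρK k ∘ₗ ρ𝔤 X ∘ₗ ρK k⁻¹ =
      ρ𝔤 ((AutomorphyDatum.gl n K hcpt).arch.Ad
        (Subgroup.inclusion (AutomorphyDatum.gl n K hcpt).arch.maximalCompact_le_carrier k) X))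
  (S : Finset {w : InfinitePlace K // w.IsReal}) (lam : (K →+* ℂ) → Fin n → ℤ)
  {𝔫 : Ideal (𝓞 K)} (h𝔫 : 𝔫 ≠ 0) {j : V →ₗ[ℂ] π.W}

set_option maxHeartbeats 800000 in
-- the complexes are abbrev towers over the datum
/-- **Transport of non-zero basic cochains along an injective intertwiner into the invariants.**  Let
`j : V → W` be an INJECTIVE intertwiner of `(𝔤, K_∞)`-modules with values in `e_{K(𝔫)} W` (`e ∘ j = j`).
Then `(j ⊗ 1)_*` maps every non-zero cochain `z ∈ C^{q+1}(𝔤, K_∞; V ⊗ (E_λ ⊗ ε_S))` with `i_Z z = 0` to a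
non-zero level-`𝔫`-fixed cochain of `gkComplexLS π S λ` with `i_Z = 0`.
[cite: BorelWallach2000, I §5.1] [cite: Clozel1990, §3.5 (p. 123)] -/
theorem exists_nonzero_levelFixed_basic_of_moduleHom
    (hjK : ∀ k : (AutomorphyDatum.gl n K hcpt).arch.maximalCompact, j ∘ₗ ρK k = π.kRepW k ∘ₗ j)
    (hj𝔤 : ∀ X : (AutomorphyDatum.gl n K hcpt).arch.lie, j ∘ₗ ρ𝔤 X = π.lieRepW X ∘ₗ j)
    (hj : Function.Injective j) (hje : ∀ v : V, levelProj π h𝔫 (j v) = j v) {q : ℕ}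
    {z : Literature.Algebra.Lie.ChevalleyEilenberg.Cochain ℝ (AutomorphyDatum.gl n K hcpt).arch.lie (CarrierV ρ𝔤 lam) (q + 1)}
    (hz : z ∈ (gkComplexV ρK ρ𝔤 had S lam).carrier (q + 1))
    (hins : ins q (⟨1, trivial⟩ : (AutomorphyDatum.gl n K hcpt).arch.lie) z = 0) (hne : z ≠ 0) :
    ∃ η : Cochain π lam (q + 1), η ∈ (gkComplexLS π S lam).carrier (q + 1) ∧ IsLevelFixed π lam 𝔫 η ∧
      ins q (⟨1, trivial⟩ : (AutomorphyDatum.gl n K hcpt).arch.lie) η = 0 ∧ η ≠ 0 := by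
  refine ⟨map (AutomorphyDatum.gl n K hcpt).arch.lie (moduleHom π lam j hj𝔤) (q + 1) z, ?_, ?_, ?_, ?_⟩
  · -- `(j ⊗ 1)_*` is a cochain map of the `(𝔤, K_∞)`-complexes
    have h := (isCochainMapTo_hom (AutomorphyDatum.gl n K hcpt).arch (ρK.tprod (σSK hcpt S lam))
      (GKTensor.lie (AutomorphyDatum.gl n K hcpt).arch ρ𝔤 (σ𝔤S hcpt lam)) (π.kRepW.tprod (σSK hcpt S lam))
      (GKTensor.lie (AutomorphyDatum.gl n K hcpt).arch π.lieRepW (σ𝔤S hcpt lam))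
      (GKTensor.ad_compat (AutomorphyDatum.gl n K hcpt).arch ρK ρ𝔤 (σSK hcpt S lam) (σ𝔤S hcpt lam) had
        (σS_ad_compat S lam))
      (GKTensor.ad_compat (AutomorphyDatum.gl n K hcpt).arch π.kRepW π.lieRepW (σSK hcpt S lam) (σ𝔤S hcpt lam)
        π.kRepW_lieRepW_ad_compat (σS_ad_compat S lam))
      (j.rTensor (ResGLnCohomology.CoeffModule ℂ n K lam)) (rTensor_comp_lieV π lam j hj𝔤)
      (rTensor_comp_tprodV π ρK S lam j hjK)).mapsTo (q + 1) z hz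
    exact h
  · -- the values `(j ⊗ 1)(z w)` are `K(𝔫)`-fixed
    intro w u hu
    change (π.finiteRepW _).rTensor (ResGLnCohomology.CoeffModule ℂ n K lam)
        (j.rTensor (ResGLnCohomology.CoeffModule ℂ n K lam)
          (@id (V ⊗[ℂ] ResGLnCohomology.CoeffModule ℂ n K lam) (z w))) =
      j.rTensor (ResGLnCohomology.CoeffModule ℂ n K lam) (@id (V ⊗[ℂ] ResGLnCohomology.CoeffModule ℂ n K lam) (z w))
    rw [← LinearMap.comp_apply, ← LinearMap.rTensor_comp,
      finiteRepW_comp_eq_of_levelProj π h𝔫 hje (ofFinite_mem_levelFin hu)]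
  · -- `i_Z` commutes with `(j ⊗ 1)_*`
    rw [ins_map, hins, map_zero]
  · -- `(j ⊗ 1)_*` is injective
    intro h0
    exact hne (map_injective (moduleHom π lam j hj𝔤) (moduleHom_injective π lam j hj𝔤 hj) (q + 1)
      (h0.trans (map_zero _).symm))

end Transport

open Literature.NumberTheory.DiophantineGeometry Literature.Barriers.Langlands in
/-- **Clozel's Lemme 3.14/3.15 reduced to a non-zero basic cochain of a `(𝔤, K_∞)`-module embedded in the
`K(𝔫)`-invariants.**  The apex fact `Clozel1990_exists_basic_levelFixed_cocycle` holds as soon as, for every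
`n ≥ 2`, `𝔫 ≠ 0`, dominant `λ` and clean cohomological cuspidal `π` of `GL_n(𝔸_K)` with a non-zero
`K(𝔫)`-fixed form, there are a set `S` of real places, a complex vector space `V` with a representation `ρK`
of `K_∞` and a compatible action `ρ𝔤` of `𝔤`, an INJECTIVE `ℂ`-linear `j : V → W` intertwining `(ρK, ρ𝔤)`
with `(r|_{K_∞}, Lie derivative)` and taking values in `e_{K(𝔫)} W`, and a non-zero cochain
`z ∈ C^{q+1}(𝔤, K_∞; V ⊗ (E_λ(ℂ) ⊗ ε_S))` with `i_Z z = 0` (`…_of_nonzero_cochain` and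
`exists_nonzero_levelFixed_basic_of_moduleHom`).  In print `V = π_∞ ↪ W^{K(𝔫)} ≅ π_∞ ⊗ π_f^{K(𝔫)}` and
`Hom_{K_∞}(Λ^{q+1}(𝔤/(𝔨 ⊕ ℝZ)), π_∞ ⊗ E_λ ⊗ ε_S) ≠ 0` (Lemme 3.14).
[cite: Clozel1990, Lemme 3.14 (p. 114), Lemme 3.15 (p. 121), §3.5 (p. 123)] [cite: BorelWallach2000, I §5.1] -/
theorem Clozel1990_exists_basic_levelFixed_cocycle_of_nonzero_moduleCochain
    (H : ∀ (n : ℕ) (K : Type) [Field K] [NumberField K] (hcpt : isCompact_glFiniteIntegralLevel n K)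
      (𝔫 : Ideal (𝓞 K)) (lam : (K →+* ℂ) → Fin n → ℤ), 2 ≤ n → ∀ h𝔫 : 𝔫 ≠ 0,
      (∀ τ, Weight.IsDominant (lam τ)) →
      ∀ π : CuspidalAutomorphicRepData n K hcpt, π.1.W' = ⊥ →
        (∃ μ : ℂ, ∀ c ∈ π.1.W, lieDeriv (AutomorphyDatum.gl n K hcpt).ofArch
          (⟨1, trivial⟩ : (AutomorphyDatum.gl n K hcpt).arch.lie) c = μ • c) →
        (∃ T : InfinityType K n, π.1.HasInfinityType T ∧
          ∀ τ : K →+* ℂ, (T τ).map ArchWeight.a =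
            (cohomologicalInfinityType n K (Weight.dual (lam τ)) τ).map ArchWeight.a) →
        (∃ φ ∈ π.1.W, φ ≠ 0 ∧
          ∀ u ∈ principalCongruenceLevel n K 𝔫, rightTranslation (AdelicGroupData.gl n K) u φ = φ) →
        ∃ (S : Finset {w : InfinitePlace K // w.IsReal}) (V : Type) (_ : AddCommGroup V) (_ : Module ℂ V)
          (ρK : Representation ℂ (AutomorphyDatum.gl n K hcpt).arch.maximalCompact V)
          (ρ𝔤 : (AutomorphyDatum.gl n K hcpt).arch.lie →ₗ⁅ℝ⁆ Module.End ℂ V)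
          (had : ∀ (k : (AutomorphyDatum.gl n K hcpt).arch.maximalCompact) (X : (AutomorphyDatum.gl n K hcpt).arch.lie),
            ρK k ∘ₗ ρ𝔤 X ∘ₗ ρK k⁻¹ =
              ρ𝔤 ((AutomorphyDatum.gl n K hcpt).arch.Ad
                (Subgroup.inclusion (AutomorphyDatum.gl n K hcpt).arch.maximalCompact_le_carrier k) X))
          (j : V →ₗ[ℂ] π.1.W),
          (∀ k, j ∘ₗ ρK k = π.1.kRepW k ∘ₗ j) ∧ (∀ X, j ∘ₗ ρ𝔤 X = π.1.lieRepW X ∘ₗ j) ∧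
            Function.Injective j ∧ (∀ v, levelProj π.1 h𝔫 (j v) = j v) ∧
            ∃ (q : ℕ) (z : Literature.Algebra.Lie.ChevalleyEilenberg.Cochain ℝ (AutomorphyDatum.gl n K hcpt).arch.lie
                (CarrierV ρ𝔤 lam) (q + 1)),
              z ∈ (gkComplexV ρK ρ𝔤 had S lam).carrier (q + 1) ∧
                Literature.Algebra.Lie.ChevalleyEilenberg.ins q
                    (⟨1, trivial⟩ : (AutomorphyDatum.gl n K hcpt).arch.lie) z = 0 ∧ z ≠ 0) :
    Clozel1990_exists_basic_levelFixed_cocycle := by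
  refine Clozel1990_exists_basic_levelFixed_cocycle_of_nonzero_cochain ?_
  intro n K _ _ hcpt 𝔫 lam hn h𝔫 hdom π hW' hμ hT hφ
  -- (`have` first: destructuring the applied hypothesis in one `obtain` makes the elaborator unfold the towers)
  have H' := H n K hcpt 𝔫 lam hn h𝔫 hdom π hW' hμ hT hφ
  obtain ⟨S, V, _, _, ρK, ρ𝔤, had, j, hjK, hj𝔤, hj, hje, q, z, hz, hins, hne⟩ := H'
  have h := exists_nonzero_levelFixed_basic_of_moduleHom (π := π.1) (had := had) (S := S) (lam := lam) h𝔫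
    hjK hj𝔤 hj hje hz hins hne
  obtain ⟨η, h1, h2, h3, h4⟩ := h
  refine ⟨S, q, η, h1, h2, h3, ?_⟩
  exact h4

end ConeDictionary

end Literature.NumberTheory.Automorphic

end
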